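import Summits.ValiantsHypothesis.ValiantsHypothesis.Theorems.FifoMatchingNNDivisionHardLocatedFaceExposure
import Summits.ValiantsHypothesis.ValiantsHypothesis.Theorems.FifoMatchingXcDivisionChamberCertificate
import HarnessLib

/-!
# Located faces beyond `C₀^β`, part 1: ADMISSIBLE directions, the class `E♭` (exposed-fibre-blind), the ONE-CUT RUNG

Theorems-side PORT (staged by the author val-idea-40 g4 for desk g14 / a port hand; press `--supports stmt-ValiantsHypothesis-21181
--as helper`) of the crux workfile `Cruxes/NNDivisionHard/ExposedFibre.lean` REV 3 @3c757fe0c4bc (sha16 fd9e507b00b36db6, 1003 l.;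
farm rc 0 / 0 sorry / 0 warnings; critic of record val-idea-crit-9 g1, VERDICTS #29/#30: prices P-P2d and P-P2e PAID, `#print axioms`
= {propext, Classical.choice, Quot.sound}) — proof texts VERBATIM, namespace moved `…Cruxes.NNDivisionHard.ExposedFibre40` ↦
`…Theorems.FifoMatching.ExposedFibre`, the file split by the 400-line cap into three chained modules
`…FifoMatchingNNDivisionHardExposedFibre(Rung → McCormick → Met).lean`, and made DEFINITION-FREE like the landed
`…LocatedFaceExposure` port: the workfile's `Prop`-valued predicates `BlockConst`, `BlockConstSymGen`, `Admissible`,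
`ExposedFibreBlind` and its closed `Prop` items `ExposedFibreRung`, `ExposedFibreDecided`, `McCormickLocatedDecided`, `MetFaceBlockConst`,
`MetLocatedDecided` are δ-UNFOLDED into the theorem statements (tree rule: under `Summits/` only registered obligations define
propositions), so a file that PASTED the currency (`FaceBlind41` §11a, the line's `VirtualPassenger.ExposedFibre40`) feeds its own
hypotheses to these theorems by `exact` (checked in the staged `Scratch.lean`, namespace `PasteCompatTest`); the dotted helper
names become `admissible_dot_eq_zero_iff` / `admissible_dot_le` / `admissible_face_eq`; proofs otherwise VERBATIM.  The statement-only
items of the workfile (`BlockBlind_sub_ExposedFibreBlind`, `McCormickExposedFibreBlind`, `McCormickBlockEdge`, `MetFixedPoint`,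
`ContractionClosed`, `MetContractionClosed`, `MetExposedFibreBlind`, §4 `ZonoExposedFibreBlindIff`, `ResidualHasFatFibres`) are NOT
ported — they stay in the workfile as kernel food.  THIS MODULE: §0 currency (`Jdir`; the predicates in words; `admissible_blockDir`),
§1 the one-cut rung for CLASS E♭ PROVED (`admissible_dot_eq_zero_iff`, `admissible_dot_le`, `admissible_face_eq`,
★ `exposedFibreRung_holds`, ★ `exposedFibreDecided_holds`), §1c three general tools used by parts 2–3
(`two_smul_sub_mem_of_hasEFOfSize_zero`, `funLeft_image_of_between`, `not_hasEFOfSize_zero_cor_add`).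

MECHANISM.  An ADMISSIBLE direction `c` for the block map `β : [n] → [m]` vanishes on the `β`-block-constant vertices of `COR(K_n)`
and is `< 0` on all other vertices, so `COR(K_n) ∩ {c = 0}` is the contraction face `F_β ≅ COR(K_m)` (`admissible_face_eq`; the
landed engine's `C₀^β` is one, `admissible_blockDir`).  If the maximisers of `c` among the passenger's generators pairwise differ by
multiples of `J` (class E♭), ONE application of `HasEFOfSize.face_add_face₁` gives an EF of `F_β + segment`,
the representative read `(ρ × ρ)^*` maps it onto `COR(K_m) + segment` (`funLeft_image_cor_blockFace`, `convexHull_collinear_pair`),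
and PROP A (`corPolytopeGraph_top_add_hull_three_pow_le`, `K = 2`) yields `3^m ≤ (r+1)·2^(m+1)` (`exposedFibreDecided_holds`).
Users (currently by PASTE of §0–§1b, by name once this lands): line `Cruxes/NNDivisionHard/Lines/virtual_passenger.lean` rev 15
(class `FibreBlind`, pen val-idea-42 g2) and `Cruxes/NNDivisionHard/FaceBlind.lean` rev 4 §11 (`zonoGenBlindAtDecided_holds`,
val-idea-41 g3).  Credit: statements + proofs val-idea-40 g3 (W5-P2, card `Cruxes/NNDivisionHard/Ideas/exposed-fibre-law.md`);
engine val-idea-42 / val-idea-38 / crit-9 ADVISORY #2 (`…Theorems.FifoMatching.LocatedFaceExposure`).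
HONEST FRAMING: helper rows for an OPEN crux — located-face certificates decide CLASSES of passengers (E♭; the McCormick body `M_n`;
`MET^{COR}_{n+1}`) at the Kaibel–Weltge rate; stmt-21181 `NNDivisionHard` OPEN; COR-VIRTUAL OPEN; `VP ≠ VNP` NOT proved; nothing here
is a summit statement.
-/

set_option autoImplicit false

-- the mandated summit-side namespace repeats a component by design (single-problem summit)
set_option linter.dupNamespace false

noncomputable section

open Matrix Finset
open scoped Pointwise

namespace Summit.ValiantsHypothesis.ValiantsHypothesis.Theorems.FifoMatching.ExposedFibre

open Literature.Barriers.PneNP (HasEFOfSize)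
open Literature.Combinatorics.Optimization (corPolytopeGraph corVec)
open Summit.ValiantsHypothesis.ValiantsHypothesis.Theorems.FifoMatching.LocatedFaceExposure
open Summit.ValiantsHypothesis.ValiantsHypothesis.Theorems.FifoMatching.XcDivision

variable {n m : ℕ}

/-! ## §0 Currency — DEFINITION-FREE (δ-unfolded)

No `Prop`-valued definition is declared here (tree rule: under `Summits/` only registered obligations define propositions).  The
workfile's predicates appear δ-UNFOLDED in every statement, so a file that pasted them (`FaceBlind41`, the line's `ExposedFibre40`
namespace) feeds its hypotheses to these theorems by `exact`:
* `BlockConst β b`       ≡ `∀ p q, β p = β q → b p = b q` (a `0/1` vector constant on the blocks of `β`; these index the vertices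
  of the contraction face `F_β ≅ COR(K_m)`);
* `BlockConstSymGen β g` ≡ `(∀ p p', g (p, p') = g (p', p)) ∧ ∀ p p' p'' p''', β p = β p'' → β p' = β p''' → g (p, p') = g (p'', p''')`
  (the elements of `W_β`: symmetric, `β`-block-constant);
* `Admissible β c`       ≡ `(∀ b, BlockConst β b → c ⬝ᵥ corVec ⊤ b = 0) ∧ (∀ b, ¬ BlockConst β b → c ⬝ᵥ corVec ⊤ b < 0)` — an
  **ADMISSIBLE (located) direction** for `F_β`: vanishing on the block-constant vertices of `COR(K_n)`, strictly negative on every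
  other vertex, so `COR(K_n) ∩ {c = 0} = F_β`; `C₀^β` is one (`admissible_blockDir`), so is `C₀^β + ε d` for `d ⊥ W_β`, `ε` small;
* `ExposedFibreBlind β q` ≡ `∃ c, Admissible β c ∧ ∀ j j', (∀ k, c ⬝ᵥ q k ≤ c ⬝ᵥ q j) → (∀ k, c ⬝ᵥ q k ≤ c ⬝ᵥ q j') →
  ∃ α : ℝ, q j - q j' = α • Jdir n` — **CLASS E♭ (exposed-fibre-blind)**: the maximisers of some admissible direction among the
  generators pairwise differ by multiples of `J` (the fibre of `conv q` over ONE `𝒩_β`-exposed vertex of the shadow is a `J`-segment). -/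

/-- the all-ones direction `J`. -/
def Jdir (n : ℕ) : Fin n × Fin n → ℝ := fun _ => 1

/-- the engine's direction `C₀^β` is admissible (from the landed G1 lemmas). -/
theorem admissible_blockDir (β : Fin n → Fin m) : ∃ c : Fin n × Fin n → ℝ,
    (∀ b, (∀ p q, β p = β q → b p = b q) → c ⬝ᵥ corVec (⊤ : SimpleGraph (Fin n)) b = 0) ∧
      (∀ b, ¬ (∀ p q, β p = β q → b p = b q) → c ⬝ᵥ corVec (⊤ : SimpleGraph (Fin n)) b < 0) := by
  obtain ⟨B, hB⟩ := exists_blockDir (n := n) (m := m) β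
  refine ⟨B, fun b hb => dot_eq_zero_of_blockConst β hB hb, fun b hb => ?_⟩
  rcases (blockDir_dot_corVec_le β hB b).lt_or_eq with h | h
  · exact h
  · exact absurd (blockConst_of_dot_eq_zero β hB h) hb

/-! ## §1 The ONE-CUT RUNG for class E♭ — PROVED (critic price P-P2d)

`face_add_face₁` ONCE with the admissible `c` (`COR ∩ {c = 0} = F_β` by `XcDivision.convexHull_range_inter_eq` + admissibility,
`admissible_face_eq`), the maximising generators form a `J`-collinear family (`convexHull_collinear_pair`), then the landed read
`funLeft_image_cor_blockFace`; no `blockRead_iterate`.  `m` free, as in the landed rung.  Hence (PROP A at `K + 1 = 2`,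
`corPolytopeGraph_top_add_hull_three_pow_le`) the count `3^m ≤ (r+1)·2^(m+1)` for every `E♭`-certified block map with `m` blocks. -/



/-- for an admissible `c`: `c ⬝ᵥ corVec b = 0 ↔ b` is block-constant. -/
theorem admissible_dot_eq_zero_iff {β : Fin n → Fin m} {c : Fin n × Fin n → ℝ}
    (hc : ((∀ b, (∀ p q, β p = β q → b p = b q) → c ⬝ᵥ corVec (⊤ : SimpleGraph (Fin n)) b = 0) ∧
      (∀ b, ¬ (∀ p q, β p = β q → b p = b q) → c ⬝ᵥ corVec (⊤ : SimpleGraph (Fin n)) b < 0)))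
    (b : Fin n → Bool) : c ⬝ᵥ corVec (⊤ : SimpleGraph (Fin n)) b = 0 ↔ ∀ p q, β p = β q → b p = b q := by
  constructor
  · intro h
    by_contra hb
    exact (hc.2 b hb).ne h
  · exact hc.1 b

/-- an admissible `c` is valid on the vertices of `COR(K_n)` with maximum `0`. -/
theorem admissible_dot_le {β : Fin n → Fin m} {c : Fin n × Fin n → ℝ}
    (hc : ((∀ b, (∀ p q, β p = β q → b p = b q) → c ⬝ᵥ corVec (⊤ : SimpleGraph (Fin n)) b = 0) ∧
      (∀ b, ¬ (∀ p q, β p = β q → b p = b q) → c ⬝ᵥ corVec (⊤ : SimpleGraph (Fin n)) b < 0)))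
    (b : Fin n → Bool) : c ⬝ᵥ corVec (⊤ : SimpleGraph (Fin n)) b ≤ 0 := by
  by_cases hb : ∀ p q, β p = β q → b p = b q
  · exact (hc.1 b hb).le
  · exact (hc.2 b hb).le

/-- the `c`-face of `COR(K_n)` IS the contraction face `F_β` (as cut by the engine's `C₀^β`). -/
theorem admissible_face_eq {β : Fin n → Fin m} {c : Fin n × Fin n → ℝ}
    (hc : ((∀ b, (∀ p q, β p = β q → b p = b q) → c ⬝ᵥ corVec (⊤ : SimpleGraph (Fin n)) b = 0) ∧
      (∀ b, ¬ (∀ p q, β p = β q → b p = b q) → c ⬝ᵥ corVec (⊤ : SimpleGraph (Fin n)) b < 0)))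
    {B : Fin n × Fin n → ℝ}
    (hB : ∀ x : Fin n × Fin n → ℝ,
      B ⬝ᵥ x = ∑ p : Fin n, ∑ q : Fin n, if β q = β p ∧ q ≠ p then x (p, q) - x (p, p) else 0) :
    corPolytopeGraph (⊤ : SimpleGraph (Fin n)) ∩ {x | c ⬝ᵥ x = 0} =
      corPolytopeGraph (⊤ : SimpleGraph (Fin n)) ∩ {x | B ⬝ᵥ x = 0} := by
  unfold corPolytopeGraph
  rw [convexHull_range_inter_eq _ c 0 (admissible_dot_le hc),
    convexHull_range_inter_eq _ B 0 (blockDir_dot_corVec_le β hB)]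
  congr 1
  ext x
  simp only [Set.mem_range]
  constructor
  · rintro ⟨⟨b, hb⟩, rfl⟩
    exact ⟨⟨b, dot_eq_zero_of_blockConst β hB ((admissible_dot_eq_zero_iff hc b).1 hb)⟩, rfl⟩
  · rintro ⟨⟨b, hb⟩, rfl⟩
    exact ⟨⟨b, (admissible_dot_eq_zero_iff hc b).2 (blockConst_of_dot_eq_zero β hB hb)⟩, rfl⟩

open Classical in
/-- ★ **THE ONE-CUT RUNG** (the workfile's `ExposedFibreRung`, δ-unfolded): if `q` is exposed-fibre-blind for `β` (with a
section `ρ`), an EF of `COR(K_n) + conv q` of size `r` gives one of `COR(K_m) + (segment or point)` of size `r` — one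
`face_add_face₁` with the admissible direction, `admissible_face_eq`, the maximising generators form a `J`-collinear family
(`convexHull_collinear_pair`), then the landed read `funLeft_image_cor_blockFace`. -/
theorem exposedFibreRung_holds :
    ∀ (n m : ℕ) (β : Fin n → Fin m) (ρ : Fin m → Fin n), (∀ t, β (ρ t) = t) →
      ∀ (K : ℕ) (q : Fin (K + 1) → (Fin n × Fin n → ℝ)) (r : ℕ),
        (∃ c : Fin n × Fin n → ℝ,
        ((∀ b, (∀ p q, β p = β q → b p = b q) → c ⬝ᵥ corVec (⊤ : SimpleGraph (Fin n)) b = 0) ∧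
          (∀ b, ¬ (∀ p q, β p = β q → b p = b q) → c ⬝ᵥ corVec (⊤ : SimpleGraph (Fin n)) b < 0)) ∧
        ∀ j j', (∀ k, c ⬝ᵥ q k ≤ c ⬝ᵥ q j) → (∀ k, c ⬝ᵥ q k ≤ c ⬝ᵥ q j') → ∃ α : ℝ, q j - q j' = α • Jdir n) →
        HasEFOfSize (corPolytopeGraph (⊤ : SimpleGraph (Fin n)) + convexHull ℝ (Set.range q)) r →
          ∃ q' : Fin 2 → (Fin m × Fin m → ℝ),
            HasEFOfSize (corPolytopeGraph (⊤ : SimpleGraph (Fin m)) + convexHull ℝ (Set.range q')) r := by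
  intro n m β ρ hρ K q r hE hEF
  obtain ⟨c, hc, hthin⟩ := hE
  obtain ⟨B, hB⟩ := exists_blockDir β
  obtain ⟨j₀, -, hmax⟩ :=
    Finset.exists_max_image Finset.univ (fun j => c ⬝ᵥ q j) Finset.univ_nonempty
  have hQ : ∀ y ∈ convexHull ℝ (Set.range q), c ⬝ᵥ y ≤ c ⬝ᵥ q j₀ :=
    dot_le_of_mem_convexHull _ _ _ (by rintro _ ⟨j, rfl⟩; exact hmax j (Finset.mem_univ _))
  have hP : ∀ x ∈ corPolytopeGraph (⊤ : SimpleGraph (Fin n)), c ⬝ᵥ x ≤ 0 :=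
    dot_le_of_mem_convexHull _ _ _ (by rintro _ ⟨b, rfl⟩; exact admissible_dot_le hc b)
  have h0 := hEF.face_add_face₁ c 0 (c ⬝ᵥ q j₀) hP hQ
  rw [admissible_face_eq hc hB] at h0
  have hQeq : convexHull ℝ (Set.range q) ∩ {y | c ⬝ᵥ y = c ⬝ᵥ q j₀} =
      convexHull ℝ (q '' ((Finset.univ.filter fun j => c ⬝ᵥ q j = c ⬝ᵥ q j₀ : Finset (Fin (K + 1))) :
        Set (Fin (K + 1)))) := by
    rw [convexHull_range_inter_eq q c _ (fun j => hmax j (Finset.mem_univ _))]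
    congr 1
    ext y
    constructor
    · rintro ⟨⟨j, hj⟩, rfl⟩
      exact ⟨j, Finset.mem_coe.2 (Finset.mem_filter.2 ⟨Finset.mem_univ _, hj⟩), rfl⟩
    · rintro ⟨j, hj, rfl⟩
      exact ⟨⟨j, (Finset.mem_filter.1 (Finset.mem_coe.1 hj)).2⟩, rfl⟩
  rw [hQeq] at h0
  have hj₀ : j₀ ∈ (Finset.univ.filter fun j => c ⬝ᵥ q j = c ⬝ᵥ q j₀ : Finset (Fin (K + 1))) :=
    Finset.mem_filter.2 ⟨Finset.mem_univ _, rfl⟩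
  have hSmax : ∀ j ∈ (Finset.univ.filter fun j => c ⬝ᵥ q j = c ⬝ᵥ q j₀ : Finset (Fin (K + 1))),
      ∀ k, c ⬝ᵥ q k ≤ c ⬝ᵥ q j := fun j hj k => by
    rw [(Finset.mem_filter.1 hj).2]
    exact hmax k (Finset.mem_univ _)
  have hαex : ∀ j, ∃ α : ℝ, j ∈ (Finset.univ.filter fun j => c ⬝ᵥ q j = c ⬝ᵥ q j₀ : Finset (Fin (K + 1))) →
      q j - q j₀ = α • Jdir n := by
    intro j
    by_cases hj : j ∈ (Finset.univ.filter fun j => c ⬝ᵥ q j = c ⬝ᵥ q j₀ : Finset (Fin (K + 1)))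
    · obtain ⟨α, hα⟩ := hthin j j₀ (hSmax j hj) (hSmax j₀ hj₀)
      exact ⟨α, fun _ => hα⟩
    · exact ⟨0, fun h => (hj h).elim⟩
  choose α hα using hαex
  have hq : ∀ j ∈ (Finset.univ.filter fun j => c ⬝ᵥ q j = c ⬝ᵥ q j₀ : Finset (Fin (K + 1))),
      q j = q j₀ + α j • Jdir n := fun j hj => by
    rw [← hα j hj, add_sub_cancel]
  obtain ⟨a, -, b, -, hpair⟩ := convexHull_collinear_pair q (Jdir n) _ ⟨j₀, hj₀⟩ α (q j₀) hq
  rw [hpair] at h0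
  have h2 := h0.image_linearMap (LinearMap.funLeft ℝ ℝ (fun ij : Fin m × Fin m => (ρ ij.1, ρ ij.2)))
  rw [Set.image_add, funLeft_image_cor_blockFace β hB hρ, LinearMap.image_convexHull] at h2
  refine ⟨fun i => if i = 0 then LinearMap.funLeft ℝ ℝ (fun ij : Fin m × Fin m => (ρ ij.1, ρ ij.2)) (q a)
    else LinearMap.funLeft ℝ ℝ (fun ij : Fin m × Fin m => (ρ ij.1, ρ ij.2)) (q b), ?_⟩
  convert h2 using 3
  ext y
  constructor
  · rintro ⟨i, rfl⟩
    by_cases hi : i = 0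
    · exact ⟨q a, Or.inl rfl, by simp [hi]⟩
    · exact ⟨q b, Or.inr rfl, by simp [hi]⟩
  · rintro ⟨x, hx, rfl⟩
    rcases hx with rfl | hx
    · exact ⟨0, by simp⟩
    · rw [Set.mem_singleton_iff] at hx
      subst hx
      exact ⟨1, by simp⟩

/-- ★ **CLASS E♭ IS DECIDED** (the workfile's `ExposedFibreDecided`, δ-unfolded): the count `3^m ≤ (r+1)·2^(m+1)` (PROP A at
`K = 2`, ✓ `corPolytopeGraph_top_add_hull_three_pow_le`) — at `m = lvl n + 1` the line's rate, at `m = 2(log₂ n + c)^c + 4` the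
route's rate `T c n < r`. -/
theorem exposedFibreDecided_holds :
    ∀ (n m : ℕ) (β : Fin n → Fin m) (ρ : Fin m → Fin n), (∀ t, β (ρ t) = t) →
      ∀ (K : ℕ) (q : Fin (K + 1) → (Fin n × Fin n → ℝ)) (r : ℕ),
        (∃ c : Fin n × Fin n → ℝ,
        ((∀ b, (∀ p q, β p = β q → b p = b q) → c ⬝ᵥ corVec (⊤ : SimpleGraph (Fin n)) b = 0) ∧
          (∀ b, ¬ (∀ p q, β p = β q → b p = b q) → c ⬝ᵥ corVec (⊤ : SimpleGraph (Fin n)) b < 0)) ∧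
        ∀ j j', (∀ k, c ⬝ᵥ q k ≤ c ⬝ᵥ q j) → (∀ k, c ⬝ᵥ q k ≤ c ⬝ᵥ q j') → ∃ α : ℝ, q j - q j' = α • Jdir n) →
        HasEFOfSize (corPolytopeGraph (⊤ : SimpleGraph (Fin n)) + convexHull ℝ (Set.range q)) r →
          3 ^ m ≤ (r + 1) * 2 ^ (m + 1) := by
  intro n m β ρ hρ K q r hE hEF
  obtain ⟨q', hq'⟩ := exposedFibreRung_holds n m β ρ hρ K q r hE hEF
  have h := corPolytopeGraph_top_add_hull_three_pow_le q' (by norm_num) hq'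
  calc 3 ^ m ≤ 2 * (r + 1) * 2 ^ m := h
    _ = (r + 1) * 2 ^ (m + 1) := by ring

/-! ### §1c General tools (EFs of size `0`; faces of `COR(K_n)` above the contraction face) -/


/-- an EF of size `0` describes an affine subspace: it is closed under point reflections. -/
theorem two_smul_sub_mem_of_hasEFOfSize_zero {ι : Type} [Fintype ι] {S : Set (ι → ℝ)} (h : HasEFOfSize S 0)
    {u v : ι → ℝ} (hu : u ∈ S) (hv : v ∈ S) : (2 : ℝ) • u - v ∈ S := by
  obtain ⟨Q, rfl⟩ := h
  obtain ⟨yu, hyu, hu⟩ := hu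
  obtain ⟨yv, -, hv⟩ := hv
  have hy : yv = yu := funext fun i => Fin.elim0 i
  rw [hy] at hv
  refine ⟨yu, hyu, ?_⟩
  funext i
  have h1 := congrFun hu i
  have h2 := congrFun hv i
  simp only [Pi.add_apply, Matrix.mulVec_sub, Matrix.mulVec_smul, Pi.sub_apply, Pi.smul_apply,
    smul_eq_mul] at h1 h2 ⊢
  linarith

/-- the read `(ρ × ρ)^*` maps every face of `COR(K_n)` containing the contraction face ONTO `COR(K_m)`. -/
theorem funLeft_image_of_between (β : Fin n → Fin m) {B : Fin n × Fin n → ℝ}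
    (hB : ∀ x : Fin n × Fin n → ℝ,
      B ⬝ᵥ x = ∑ p : Fin n, ∑ q : Fin n, if β q = β p ∧ q ≠ p then x (p, q) - x (p, p) else 0)
    {ρ : Fin m → Fin n} (hρ : ∀ t, β (ρ t) = t) {G : Set (Fin n × Fin n → ℝ)}
    (h₁ : corPolytopeGraph (⊤ : SimpleGraph (Fin n)) ∩ {x | B ⬝ᵥ x = 0} ⊆ G)
    (h₂ : G ⊆ corPolytopeGraph (⊤ : SimpleGraph (Fin n))) :
    LinearMap.funLeft ℝ ℝ (fun ij : Fin m × Fin m => (ρ ij.1, ρ ij.2)) '' G =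
      corPolytopeGraph (⊤ : SimpleGraph (Fin m)) := by
  apply Set.Subset.antisymm
  · rintro _ ⟨x, hx, rfl⟩
    unfold corPolytopeGraph
    have hx' : x ∈ convexHull ℝ (Set.range (corVec (⊤ : SimpleGraph (Fin n)))) := h₂ hx
    have hmem : LinearMap.funLeft ℝ ℝ (fun ij : Fin m × Fin m => (ρ ij.1, ρ ij.2)) x ∈
        LinearMap.funLeft ℝ ℝ (fun ij : Fin m × Fin m => (ρ ij.1, ρ ij.2)) ''
          convexHull ℝ (Set.range (corVec (⊤ : SimpleGraph (Fin n)))) := ⟨x, hx', rfl⟩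
    rw [LinearMap.image_convexHull] at hmem
    refine convexHull_mono ?_ hmem
    rintro _ ⟨_, ⟨b, rfl⟩, rfl⟩
    refine ⟨b ∘ ρ, ?_⟩
    ext ⟨s, t⟩
    simp only [LinearMap.funLeft_apply, corVec_top_apply, Function.comp_apply]
    rfl
  · rw [← funLeft_image_cor_blockFace β hB hρ]
    exact Set.image_mono h₁

/-- `COR(K_n) + M` is never an affine subspace when `M ∋ 0` has a nonnegative diagonal entry: size `0` is impossible. -/
theorem not_hasEFOfSize_zero_cor_add (p₀ : Fin n) {M : Set (Fin n × Fin n → ℝ)} (h0M : (0 : Fin n × Fin n → ℝ) ∈ M)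
    (hM : ∀ Y ∈ M, 0 ≤ Y (p₀, p₀)) :
    ¬ HasEFOfSize (corPolytopeGraph (⊤ : SimpleGraph (Fin n)) + M) 0 := by
  intro hEF
  have h0C : (0 : Fin n × Fin n → ℝ) ∈ corPolytopeGraph (⊤ : SimpleGraph (Fin n)) := by
    unfold corPolytopeGraph
    refine subset_convexHull ℝ _ ⟨fun _ => false, ?_⟩
    ext ⟨p, q⟩
    rw [corVec_top_apply]
    simp
  have huC : corVec (⊤ : SimpleGraph (Fin n)) (fun _ => true) ∈ corPolytopeGraph (⊤ : SimpleGraph (Fin n)) := by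
    unfold corPolytopeGraph
    exact subset_convexHull ℝ _ ⟨fun _ => true, rfl⟩
  have hS0 : (0 : Fin n × Fin n → ℝ) ∈ corPolytopeGraph (⊤ : SimpleGraph (Fin n)) + M :=
    ⟨0, h0C, 0, h0M, add_zero 0⟩
  have hSu : corVec (⊤ : SimpleGraph (Fin n)) (fun _ => true) ∈ corPolytopeGraph (⊤ : SimpleGraph (Fin n)) + M :=
    ⟨_, huC, 0, h0M, add_zero _⟩
  obtain ⟨x, hx, Y, hY, hxY⟩ := two_smul_sub_mem_of_hasEFOfSize_zero hEF hS0 hSu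
  have hx0 : 0 ≤ x (p₀, p₀) := by
    unfold corPolytopeGraph at hx
    have h := dot_le_of_mem_convexHull _ (-(Pi.single (p₀, p₀) (1 : ℝ))) 0 (by
      rintro _ ⟨b, rfl⟩
      rw [neg_dotProduct, single_dotProduct, one_mul, corVec_top_apply]
      split_ifs <;> norm_num) x hx
    rw [neg_dotProduct, single_dotProduct, one_mul] at h
    linarith
  have hY0 := hM Y hY
  have h := congrFun hxY (p₀, p₀)
  simp only [Pi.add_apply, Pi.sub_apply, Pi.zero_apply, smul_zero, zero_sub, corVec_top_apply] at h
  simp at h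
  linarith

end Summit.ValiantsHypothesis.ValiantsHypothesis.Theorems.FifoMatching.ExposedFibre

end
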